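import Literature.NumberTheory.LFunctions.ClassGroupLFunctionExceptionalZeroQuadraticField
import Literature.NumberTheory.LFunctions.SiegelProductCoefficients
import HarnessLib

/-!
# Page's theorem for number fields: the exceptional zeros of all class group `L`-functions of all
# number fields in a discriminant range come from ONE real number

Topic `Literature/NumberTheory/LFunctions`, namespace `Literature.NumberTheory.LFunctions.NumberField`.
Theorem-only file (no definition, no named fact, no `sorry`), unconditional, effective.

By `exists_dirichletCharacter_realZero_of_classGroupLFunction_eq_zero` an exceptional zero (inside
Stark's window `[1 − 1/(8(2n)! log|d_K|), 1)`) of a real class group `L`-function of a number field `K`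
of degree `n > 1` is a zero of `L(s, κ)` for a quadratic Dirichlet character `κ` of modulus `M ≤ |d_K|`.
Landau's theorem (Montgomery–Vaughan Thm. 11.7, tree `DirichletZFR.exists_landau_prodChar_min_le`) and
Page's "at most one real zero" (MV Thm. 11.3 Case 4, tree `DirichletZFR.exists_min_realZeros_le`) then
give the repulsion of exceptional zeros ACROSS number fields:

* `DirichletZFR.realZeros_eq_or_min_le` — Dirichlet level: there is an absolute `c > 0` such that for
  quadratic `χ₁ ≠ 1` mod `q₁`, `χ₂ ≠ 1` mod `q₂` and real zeros `βᵢ ∈ (0, 1)` of `L(s, χᵢ)`: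
  `β₁ = β₂` or `min(β₁, β₂) ≤ 1 − c/(log(q₁q₂) + log 4)` (if `χ₁χ₂` mod `q₁q₂` is principal the two
  `L`-functions have the same zeros in `(0, 1)`, Mathlib `DirichletCharacter.LFunction_changeLevel`;
  otherwise Landau);
* `classGroupLFunction_realZeros_eq_or_min_le` — **number fields**: there is an absolute `c > 0` such
  that for number fields `K₁, K₂` of degrees `n₁, n₂ > 1`, real class group characters `χᵢ` of `Kᵢ` and
  real zeros `βᵢ ∈ [1 − 1/(8(2nᵢ)!·log|d_{Kᵢ}|), 1)` of `L(s, χᵢ)`: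
  `β₁ = β₂` or `min(β₁, β₂) ≤ 1 − c/(log(|d_{K₁}|·|d_{K₂}|) + log 4)`.

So for every `X` the numbers `β > 1 − c/(2 log X + log 4)` occurring as such exceptional zeros of number
fields with `|d_K| ≤ X` (any degrees `> 1`, any real class group characters) form a set with AT MOST ONE
element — Page's theorem [MontgomeryVaughan2007, Cor. 11.8–11.10] lifted from Dirichlet characters to
all number fields through Stark's reduction [Stark1974, Thm. 3].

IN PRINT (found by the freshness sweep after landing): a same-base-field version of this repulsion —
two potentially exceptional quadratic Hecke characters `ψ₁ ≠ ψ₂` of ONE field `k`,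
`min(β₁, β₂) ≤ 1 − 1/(12 log(q(ψ₁)q(ψ₂)))`, via Stark's zero-free region for the biquadratic compositum —
is **Lemma 13** of Cho–Lemke Oliver–Zaman, arXiv:2510.02309 (2025), §5. The present file treats class group
characters of two possibly DIFFERENT number fields, through the descent to quadratic Dirichlet characters
and Landau's theorem. [ChoLemkeOliverZaman2025]

## References

* P. J. Cho, R. J. Lemke Oliver, A. Zaman, *Effective Brauer–Siegel theorems for Artin L-functions*,
  arXiv:2510.02309 (2025), §5 Lemma 13. [ChoLemkeOliverZaman2025]
* H. L. Montgomery, R. C. Vaughan, *Multiplicative Number Theory I*, CUP 2007, Thm. 11.3, Thm. 11.7,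
  Cor. 11.8–11.10. [MontgomeryVaughan2007]
* H. M. Stark, *Some effective cases of the Brauer–Siegel theorem*, Invent. Math. 23 (1974) 135–152,
  Thm. 3. [Stark1974]
* V. Kumar Murty, *Stark zeros in certain towers of fields*, Math. Res. Lett. 6 (1999) 511–519
  ("Stark zeros"). [Murty1999StarkZeros]
-/

noncomputable section

open scoped NumberField nonZeroDivisors
open Complex NumberField Module

namespace Literature.NumberTheory.LFunctions.DirichletZFR

open Literature.NumberTheory.LFunctions.SiegelCoefficients DirichletCharacter

/-- The Euler factor `1 − χ(p) p^{−β}` does not vanish for real `β > 0` (`|χ(p)| ≤ 1`, `p^{−β} < 1`).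
[folklore] -/
theorem one_sub_mul_cpow_ne_zero {q : ℕ} (χ : DirichletCharacter ℂ q) {p : ℕ} (hp : p.Prime)
    {β : ℝ} (hβ : 0 < β) : (1 : ℂ) - χ (p : ZMod q) * (p : ℂ) ^ (-(β : ℂ)) ≠ 0 := by
  intro h
  have h1 : χ (p : ZMod q) * (p : ℂ) ^ (-(β : ℂ)) = 1 := (sub_eq_zero.mp h).symm
  have hχ : ‖χ (p : ZMod q)‖ ≤ 1 := χ.norm_le_one _
  have hp1 : (1 : ℝ) < p := by exact_mod_cast hp.one_lt
  have hcpow : ‖(p : ℂ) ^ (-(β : ℂ))‖ = (p : ℝ) ^ (-β) := by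
    rw [show (-(β : ℂ)) = ((-β : ℝ) : ℂ) by push_cast; ring,
      Complex.norm_natCast_cpow_of_pos hp.pos, Complex.ofReal_re]
  have hlt : (p : ℝ) ^ (-β) < 1 := Real.rpow_lt_one_of_one_lt_of_neg hp1 (by linarith)
  have h0 : 0 ≤ (p : ℝ) ^ (-β) := Real.rpow_nonneg (by positivity) _
  have hnorm : ‖χ (p : ZMod q) * (p : ℂ) ^ (-(β : ℂ))‖ < 1 := by
    rw [norm_mul, hcpow]
    calc ‖χ (p : ZMod q)‖ * (p : ℝ) ^ (-β) ≤ 1 * (p : ℝ) ^ (-β) :=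
          mul_le_mul_of_nonneg_right hχ h0
      _ < 1 := by rw [one_mul]; exact hlt
  rw [h1, norm_one] at hnorm
  exact lt_irrefl _ hnorm

/-- If the lifts of `χ₁` mod `q₁` and `χ₂` mod `q₂` to the modulus `q₁q₂` coincide, then every real
zero `β ∈ (0, 1)` of `L(s, χ₂)` is a zero of `L(s, χ₁)` (the two `L`-functions differ from that of the
common lift by finitely many non-vanishing Euler factors, Mathlib
`DirichletCharacter.LFunction_changeLevel`). [folklore] -/
theorem LFunction_eq_zero_of_changeLevel_eq {q₁ q₂ : ℕ} [NeZero q₁] [NeZero q₂]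
    {χ₁ : DirichletCharacter ℂ q₁} {χ₂ : DirichletCharacter ℂ q₂}
    (heq : changeLevel (dvd_mul_right q₁ q₂) χ₁ = changeLevel (dvd_mul_left q₂ q₁) χ₂)
    {β : ℝ} (hβ : 0 < β) (hβ1 : β < 1) (hz : χ₂.LFunction β = 0) : χ₁.LFunction β = 0 := by
  haveI : NeZero (q₁ * q₂) := ⟨Nat.mul_ne_zero (NeZero.ne q₁) (NeZero.ne q₂)⟩
  have hs : (β : ℂ) ≠ 1 := by
    intro h; have := congrArg Complex.re h; simp at this; linarith
  have h1 := LFunction_changeLevel (dvd_mul_right q₁ q₂) χ₁ (s := (β : ℂ)) (Or.inr hs)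
  have h2 := LFunction_changeLevel (dvd_mul_left q₂ q₁) χ₂ (s := (β : ℂ)) (Or.inr hs)
  rw [heq, h2, hz, zero_mul] at h1
  -- `0 = L(β, χ₁) · ∏ (1 − χ₁(p) p^{−β})` with a non-vanishing product
  have hprod : ∏ p ∈ (q₁ * q₂).primeFactors, ((1 : ℂ) - χ₁ (p : ZMod q₁) * (p : ℂ) ^ (-(β : ℂ))) ≠ 0 :=
    Finset.prod_ne_zero_iff.mpr fun p hp => one_sub_mul_cpow_ne_zero χ₁ (Nat.prime_of_mem_primeFactors hp) hβ
  rcases mul_eq_zero.mp h1.symm with h | h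
  · exact h
  · exact absurd h hprod

/-- **Landau–Page for pairs of quadratic characters of possibly different moduli.** There is an absolute
`c > 0` such that for quadratic `χ₁ ≠ 1` mod `q₁`, `χ₂ ≠ 1` mod `q₂` and real zeros `β₁, β₂ ∈ (0,1)` of
`L(s, χ₁)`, `L(s, χ₂)`: either `β₁ = β₂`, or `min(β₁, β₂) ≤ 1 − c/(log(q₁q₂) + log 4)`.
(If `χ₁χ₂` mod `q₁q₂` is non-principal: Landau, MV Thm. 11.7; if it is principal the lifts of `χ₁, χ₂`
coincide, `β₂` is a zero of `L(s, χ₁)` too, and Page's MV Thm. 11.3 Case 4 applies.)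
[cite: MontgomeryVaughan2007, Theorem 11.7 and Theorem 11.3 (Case 4)] -/
theorem realZeros_eq_or_min_le :
    ∃ c : ℝ, 0 < c ∧ ∀ (q₁ q₂ : ℕ) [NeZero q₁] [NeZero q₂]
      (χ₁ : DirichletCharacter ℂ q₁) (χ₂ : DirichletCharacter ℂ q₂),
      χ₁ ≠ 1 → χ₂ ≠ 1 → χ₁ ^ 2 = 1 → χ₂ ^ 2 = 1 →
      ∀ β₁ β₂ : ℝ, 0 < β₁ → β₁ < 1 → 0 < β₂ → β₂ < 1 →
        χ₁.LFunction β₁ = 0 → χ₂.LFunction β₂ = 0 →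
          β₁ = β₂ ∨ min β₁ β₂ ≤ 1 - c / (Real.log ((q₁ : ℝ) * q₂) + Real.log 4) := by
  obtain ⟨cL, hcL, hL⟩ := exists_landau_prodChar_min_le
  obtain ⟨cP, hcP, hP⟩ := exists_min_realZeros_le
  refine ⟨min cL cP, lt_min hcL hcP, fun q₁ q₂ _ _ χ₁ χ₂ hχ₁ hχ₂ h₁ h₂ β₁ β₂ hβ₁0 hβ₁1 hβ₂0 hβ₂1 hz₁ hz₂ => ?_⟩
  have hq₁ : (1 : ℝ) ≤ q₁ := by exact_mod_cast Nat.one_le_iff_ne_zero.mpr (NeZero.ne q₁)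
  have hq₂ : (1 : ℝ) ≤ q₂ := by exact_mod_cast Nat.one_le_iff_ne_zero.mpr (NeZero.ne q₂)
  have hlog4 : 0 < Real.log 4 := Real.log_pos (by norm_num)
  have hlog12 : 0 ≤ Real.log ((q₁ : ℝ) * q₂) := Real.log_nonneg (by nlinarith)
  have hden : 0 < Real.log ((q₁ : ℝ) * q₂) + Real.log 4 := by linarith
  by_cases hψ : prodChar χ₁ χ₂ = 1
  · -- the lifts coincide: `β₂` is a zero of `L(s, χ₁)`; Page for `χ₁`
    have heq : changeLevel (dvd_mul_right q₁ q₂) χ₁ = changeLevel (dvd_mul_left q₂ q₁) χ₂ := by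
      have hsq : changeLevel (dvd_mul_left q₂ q₁) χ₂ * changeLevel (dvd_mul_left q₂ q₁) χ₂ = 1 := by
        rw [← sq, ← map_pow, h₂, map_one]
      have h := congrArg (· * changeLevel (dvd_mul_left q₂ q₁) χ₂) hψ
      simp only [prodChar, mul_assoc, hsq, mul_one, one_mul] at h
      exact h
    have hz₂' : χ₁.LFunction β₂ = 0 := LFunction_eq_zero_of_changeLevel_eq heq hβ₂0 hβ₂1 hz₂
    by_cases hb : β₁ = β₂
    · exact Or.inl hb
    · right
      have h := hP q₁ χ₁ hχ₁ β₁ β₂ hz₁ hz₂' hb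
      have hlogq : Real.log (q₁ : ℝ) ≤ Real.log ((q₁ : ℝ) * q₂) :=
        Real.log_le_log (by linarith) (by nlinarith)
      have hlogq0 : 0 < Real.log (q₁ : ℝ) + Real.log 4 := by
        have := Real.log_nonneg hq₁; linarith
      have h1 : min cL cP / (Real.log ((q₁ : ℝ) * q₂) + Real.log 4) ≤ cP / (Real.log (q₁ : ℝ) + Real.log 4) :=
        calc min cL cP / (Real.log ((q₁ : ℝ) * q₂) + Real.log 4)
            ≤ cP / (Real.log ((q₁ : ℝ) * q₂) + Real.log 4) :=
              div_le_div_of_nonneg_right (min_le_right _ _) hden.le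
          _ ≤ cP / (Real.log (q₁ : ℝ) + Real.log 4) :=
              div_le_div_of_nonneg_left hcP.le hlogq0 (by linarith)
      linarith
  · -- `χ₁χ₂` non-principal: Landau
    right
    have h := hL q₁ q₂ χ₁ χ₂ hχ₁ hχ₂ h₁ h₂ hψ β₁ β₂ hz₁ hz₂
    have h1 : min cL cP / (Real.log ((q₁ : ℝ) * q₂) + Real.log 4) ≤ cL / (Real.log ((q₁ : ℝ) * q₂) + Real.log 4) :=
      div_le_div_of_nonneg_right (min_le_left _ _) hden.le
    linarith

end Literature.NumberTheory.LFunctions.DirichletZFR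

namespace Literature.NumberTheory.LFunctions.NumberField

open Literature.NumberTheory.LFunctions

/-- **Page's theorem for number fields (exceptional zeros are repelled across fields).**  There is an
absolute `c > 0` such that for any two number fields `K₁, K₂` of degrees `n₁, n₂ > 1`, any real class
group characters `χ₁` of `K₁`, `χ₂` of `K₂` (`χᵢ² = 1`, trivial characters — i.e. `ζ_{Kᵢ}` — included) and
any real zeros `βᵢ` of `L(s, χᵢ)` with `1 − 1/(8·(2nᵢ)!·log|d_{Kᵢ}|) ≤ βᵢ < 1`:
either `β₁ = β₂`, or `min(β₁, β₂) ≤ 1 − c/(log(|d_{K₁}|·|d_{K₂}|) + log 4)`.  (Both zeros are zeros of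
quadratic Dirichlet `L`-functions of moduli `Mᵢ ≤ |d_{Kᵢ}|` by
`exists_dirichletCharacter_realZero_of_classGroupLFunction_eq_zero`; then
`DirichletZFR.realZeros_eq_or_min_le`.) [cite: MontgomeryVaughan2007, Theorem 11.7 and Cor. 11.8–11.10]
[cite: Stark1974, Thm. 3] -/
theorem classGroupLFunction_realZeros_eq_or_min_le :
    ∃ c : ℝ, 0 < c ∧ ∀ (K₁ : Type) [Field K₁] [NumberField K₁] (K₂ : Type) [Field K₂] [NumberField K₂],
      1 < finrank ℚ K₁ → 1 < finrank ℚ K₂ →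
      ∀ (χ₁ : ClassGroup (𝓞 K₁) →* ℂˣ) (χ₂ : ClassGroup (𝓞 K₂) →* ℂˣ), χ₁ * χ₁ = 1 → χ₂ * χ₂ = 1 →
      ∀ β₁ β₂ : ℝ,
        1 - 1 / (8 * ((2 * finrank ℚ K₁).factorial : ℝ) * Real.log ((discr K₁).natAbs : ℝ)) ≤ β₁ → β₁ < 1 →
        1 - 1 / (8 * ((2 * finrank ℚ K₂).factorial : ℝ) * Real.log ((discr K₂).natAbs : ℝ)) ≤ β₂ → β₂ < 1 →
        classGroupLFunction K₁ χ₁ β₁ = 0 → classGroupLFunction K₂ χ₂ β₂ = 0 →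
          β₁ = β₂ ∨ min β₁ β₂ ≤
            1 - c / (Real.log (((discr K₁).natAbs : ℝ) * (discr K₂).natAbs) + Real.log 4) := by
  obtain ⟨c, hc, h⟩ := DirichletZFR.realZeros_eq_or_min_le
  refine ⟨c, hc, fun K₁ _ _ K₂ _ _ hK₁ hK₂ χ₁ χ₂ hχ₁ hχ₂ β₁ β₂ hβ₁ hβ₁1 hβ₂ hβ₂1 hz₁ hz₂ => ?_⟩
  obtain ⟨M₁, hM₁0, κ₁, hM₁3, hM₁dvd, hκ₁, hsq₁, -, hL₁⟩ :=
    exists_dirichletCharacter_realZero_of_classGroupLFunction_eq_zero K₁ hK₁ χ₁ hχ₁ hβ₁ hβ₁1 hz₁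
  obtain ⟨M₂, hM₂0, κ₂, hM₂3, hM₂dvd, hκ₂, hsq₂, -, hL₂⟩ :=
    exists_dirichletCharacter_realZero_of_classGroupLFunction_eq_zero K₂ hK₂ χ₂ hχ₂ hβ₂ hβ₂1 hz₂
  -- `0 < βᵢ` (the windows lie inside `(0,1)`)
  have hpos : ∀ (K : Type) [Field K] [NumberField K], 1 < finrank ℚ K → ∀ β : ℝ,
      1 - 1 / (8 * ((2 * finrank ℚ K).factorial : ℝ) * Real.log ((discr K).natAbs : ℝ)) ≤ β → 0 < β := by
    intro K _ _ hK β hβ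
    have hdK : 3 ≤ (discr K).natAbs := three_le_natAbs_discr K hK
    have hd3 : (3 : ℝ) ≤ ((discr K).natAbs : ℝ) := by exact_mod_cast hdK
    have hlog : 0 < Real.log ((discr K).natAbs : ℝ) := Real.log_pos (by linarith)
    have hβ' : 1 - 1 / (4 * ((finrank ℚ K).factorial : ℝ) * Real.log ((discr K).natAbs : ℝ)) ≤ β := by
      have := inv_eight_twoFactorial_le (n := finrank ℚ K) hlog
      linarith
    have hk2 : 2 ≤ (finrank ℚ K).factorial := by
      have h := Nat.factorial_le (Nat.succ_le_of_lt hK)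
      rwa [Nat.factorial_two] at h
    exact pos_of_one_sub_inv_log_le hdK hk2 hβ'
  have hβ₁0 : 0 < β₁ := hpos K₁ hK₁ β₁ hβ₁
  have hβ₂0 : 0 < β₂ := hpos K₂ hK₂ β₂ hβ₂
  rcases h M₁ M₂ κ₁ κ₂ hκ₁ hκ₂ hsq₁ hsq₂ β₁ β₂ hβ₁0 hβ₁1 hβ₂0 hβ₂1 hL₁ hL₂ with hb | hmin
  · exact Or.inl hb
  · right
    -- `M₁ M₂ ≤ |d₁| |d₂|`
    have hd₁ : 3 ≤ (discr K₁).natAbs := three_le_natAbs_discr K₁ hK₁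
    have hd₂ : 3 ≤ (discr K₂).natAbs := three_le_natAbs_discr K₂ hK₂
    have hM₁le : M₁ ≤ (discr K₁).natAbs := le_of_pow_dvd_sq (by omega) (by omega) hM₁dvd
    have hM₂le : M₂ ≤ (discr K₂).natAbs := le_of_pow_dvd_sq (by omega) (by omega) hM₂dvd
    have hM₁1 : (1 : ℝ) ≤ M₁ := by exact_mod_cast (show 1 ≤ M₁ by omega)
    have hM₂1 : (1 : ℝ) ≤ M₂ := by exact_mod_cast (show 1 ≤ M₂ by omega)
    have hprod : (M₁ : ℝ) * M₂ ≤ ((discr K₁).natAbs : ℝ) * (discr K₂).natAbs :=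
      mul_le_mul (by exact_mod_cast hM₁le) (by exact_mod_cast hM₂le) (by positivity) (by positivity)
    have hlogle : Real.log ((M₁ : ℝ) * M₂) ≤ Real.log (((discr K₁).natAbs : ℝ) * (discr K₂).natAbs) :=
      Real.log_le_log (by nlinarith) hprod
    have hlog4 : 0 < Real.log 4 := Real.log_pos (by norm_num)
    have hden : 0 < Real.log ((M₁ : ℝ) * M₂) + Real.log 4 := by
      have := Real.log_nonneg (show (1 : ℝ) ≤ M₁ * M₂ by nlinarith); linarith
    have h1 : c / (Real.log (((discr K₁).natAbs : ℝ) * (discr K₂).natAbs) + Real.log 4) ≤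
        c / (Real.log ((M₁ : ℝ) * M₂) + Real.log 4) :=
      div_le_div_of_nonneg_left hc.le hden (by linarith)
    linarith

/-- **Uniqueness of the exceptional zero below `X` (Page's theorem for number fields, quotable form).**
With the absolute `c` of `classGroupLFunction_realZeros_eq_or_min_le`: for every `X ≥ 1`, any two real zeros
`β₁, β₂` — of real class group `L`-functions of ANY two number fields `K₁, K₂` of degrees `> 1` with
`|d_{K₁}|, |d_{K₂}| ≤ X`, each in its Stark window — that both exceed `1 − c/(2 log X + log 4)` are EQUAL.
[cite: MontgomeryVaughan2007, Corollary 11.8–11.10 (Page)] [cite: Stark1974, Thm. 3] -/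
theorem classGroupLFunction_exceptionalZero_unique :
    ∃ c : ℝ, 0 < c ∧ ∀ X : ℝ, 1 ≤ X →
      ∀ (K₁ : Type) [Field K₁] [NumberField K₁] (K₂ : Type) [Field K₂] [NumberField K₂],
      1 < finrank ℚ K₁ → 1 < finrank ℚ K₂ →
      ((discr K₁).natAbs : ℝ) ≤ X → ((discr K₂).natAbs : ℝ) ≤ X →
      ∀ (χ₁ : ClassGroup (𝓞 K₁) →* ℂˣ) (χ₂ : ClassGroup (𝓞 K₂) →* ℂˣ), χ₁ * χ₁ = 1 → χ₂ * χ₂ = 1 →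
      ∀ β₁ β₂ : ℝ,
        1 - 1 / (8 * ((2 * finrank ℚ K₁).factorial : ℝ) * Real.log ((discr K₁).natAbs : ℝ)) ≤ β₁ → β₁ < 1 →
        1 - 1 / (8 * ((2 * finrank ℚ K₂).factorial : ℝ) * Real.log ((discr K₂).natAbs : ℝ)) ≤ β₂ → β₂ < 1 →
        classGroupLFunction K₁ χ₁ β₁ = 0 → classGroupLFunction K₂ χ₂ β₂ = 0 →
        1 - c / (2 * Real.log X + Real.log 4) < β₁ → 1 - c / (2 * Real.log X + Real.log 4) < β₂ →
          β₁ = β₂ := by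
  obtain ⟨c, hc, h⟩ := classGroupLFunction_realZeros_eq_or_min_le
  refine ⟨c, hc, fun X hX K₁ _ _ K₂ _ _ hK₁ hK₂ hd₁ hd₂ χ₁ χ₂ hχ₁ hχ₂ β₁ β₂ hβ₁ hβ₁1 hβ₂ hβ₂1 hz₁ hz₂
    hX₁ hX₂ => ?_⟩
  rcases h K₁ K₂ hK₁ hK₂ χ₁ χ₂ hχ₁ hχ₂ β₁ β₂ hβ₁ hβ₁1 hβ₂ hβ₂1 hz₁ hz₂ with heq | hmin
  · exact heq
  · exfalso
    -- `log(d₁ d₂) ≤ 2 log X`, so the repulsion bound is `≤ 1 − c/(2 log X + log 4) < min β₁ β₂`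
    have hd₁3 : (3 : ℝ) ≤ ((discr K₁).natAbs : ℝ) := by exact_mod_cast three_le_natAbs_discr K₁ hK₁
    have hd₂3 : (3 : ℝ) ≤ ((discr K₂).natAbs : ℝ) := by exact_mod_cast three_le_natAbs_discr K₂ hK₂
    have hprod : ((discr K₁).natAbs : ℝ) * (discr K₂).natAbs ≤ X * X :=
      mul_le_mul hd₁ hd₂ (by positivity) (by linarith)
    have hlog : Real.log (((discr K₁).natAbs : ℝ) * (discr K₂).natAbs) ≤ 2 * Real.log X := by
      have h1 := Real.log_le_log (by positivity) hprod
      have h2 : Real.log (X * X) = 2 * Real.log X := by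
        rw [Real.log_mul (by linarith) (by linarith)]; ring
      linarith
    have hlog4 : 0 < Real.log 4 := Real.log_pos (by norm_num)
    have hlog9 : 0 ≤ Real.log (((discr K₁).natAbs : ℝ) * (discr K₂).natAbs) :=
      Real.log_nonneg (by nlinarith)
    have hle : c / (2 * Real.log X + Real.log 4) ≤
        c / (Real.log (((discr K₁).natAbs : ℝ) * (discr K₂).natAbs) + Real.log 4) :=
      div_le_div_of_nonneg_left hc.le (by linarith) (by linarith)
    have hmin' : min β₁ β₂ ≤ 1 - c / (2 * Real.log X + Real.log 4) := by linarith
    rcases min_choice β₁ β₂ with hm | hm <;> rw [hm] at hmin' <;> linarith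

end Literature.NumberTheory.LFunctions.NumberField

end
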